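/-
COR-CM (cell pub-hodgecm2, stage 2 of the Hodge ladder) — Δ2 BRIDGE, VERSION-B item (1)(d) «THE PIECES AT THE TOWER DICTIONARY»
(ASSEMBLER DECISION #8, HOME/INBOX l. 11019; fixed signatures `HOME/d2bridge/PIN-SIGNATURES.assembler.lean`, binder `pieces` of
`PinSignatures.thm418C_ofTower_of_pins`).  Seat prover-pub-hodgecm2-d2bridge-prove-8-g0-0 (pair d2bridge-prove-3).
THEOREMS ONLY; hole-free: imports the landed kernels `CorCM/D2Bridge/HcmPieces` (v4, p366132), `CorCM/D2Bridge/OmegaLevelwisePullback`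
(S2, p365699), `CorCM/D2Bridge/HcmS4Functoriality` (S4 core, p365786) and the tree's tower dictionary `HodgeCM/Model/LiuDictionaryTower`
(port layer 46 — imported, never edited); OUTSIDE the frozen port manifest.  Nothing landed is edited or restated; no named fact, no `sorry`.
FRAMING: HC_CM is NOT proved; «Δ2 BRIDGE CLOSED» is NOT claimed; hLiu at the constructed objects is a READING (r8) until every pin is a
theorem and the referee signs; no pointer ∕ count ∕ hM token.
-/
import Summits.HodgeConjecture.CorCM.D2Bridge.HcmPieces
import Summits.HodgeConjecture.CorCM.D2Bridge.OmegaLevelwisePullback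
import Summits.HodgeConjecture.CorCM.D2Bridge.HcmS4Functoriality
import Summits.HodgeConjecture.HodgeCM.Model.LiuDictionaryTower
import HarnessLib

/-!
# Δ2 bridge, pin (d): the pieces `HcmPieces` AT THE TOWER DICTIONARY `LiuDictionary.ofTower …`, from the named junction inputs

[Liu2021] Y. Liu, *Fourier–Jacobi cycles and arithmetic relative trace formula*, Camb. J. Math. **9** (2021) 1–147 =
arXiv:2102.11518; `l. NNNN` = lines of the author's TeX `FJcycle.tex`.

## What this file is

The resolved Δ2 increment (✔ `HcmPieces.lean` v4: `thm418Combined_of_asPrinted_resolved_small`, and its `LiuDictionary.Thm418C` forms,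
assembler's `Thm418COfPieces` v3 ∕ `PinSignatures.thm418C_ofTower_of_pins`) asks, per good index `i` and per level `K` below the
threshold, for ONE inhabitant of

  `HcmPieces (toThm418Data C (R i …)) (M i …) T.H (jH i …) K.K (H¹(P_K; ℂ)) (T.res K) (T.cmClasses K i)`

— the four sublemmas S1–S4 of the CM-side contract `hcm` as DATA + LAWS (the proof's map (4.2) at a level-`K` generator IS Betti
pull-back along the real morphism, [Liu2021] Rem. 4.17 ∕ Thm. 4.18 (1); tower bookkeeping and Lem. 2.4 (1); Liu's own CM datum
(Def. 4.5 (2)) is admissible; functoriality of `f ↦ f^*`, proof of Thm. 4.18 l. 2247–2253).  At the TOWER DICTIONARY of record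
`T := LiuDictionary.ofTower hHD hI h₁ h₃ hA V Char Adm Ω PhiMu adm` (`Model/LiuDictionaryTower.lean` :63; the literal pin
`liuDictionaryPin …` is its `rfl`-specialisation, DECISION #8) one has `T.H = Tower …`, `T.res K = resTotal … K`,
`T.cmClasses K i = ⋃ d, ⋃ (_ : adm i d), range (geomClass K d)` — all by `rfl`.

THIS FILE builds that inhabitant, ONCE, for
* ANY record `M : Map43RationalData` over the one-object rest `toThm418Data C (restOne C emb ιg hμ hw Car Eps epsOf Chi omega rho rhoΩ)`
  (the currency of ✔ `map43RecordOfLevels` ∕ the J-record pin `map43RecordAtPin`; `Eps ∕ epsOf ∕ omega ∕ rho ∕ rhoΩ` are FREE, so the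
  theorem applies verbatim at the δ′ rests `restOfCharDeltaPrime … = U.rest (restTailOne …)`, which are `restOne …` by `rfl`),
  whose pull-back `P` is the CONSTRUCTED (4.2) (`hMP : M.P = PΩOne … Λ`, a `rfl` for the J-record) — this is S2 (✔ `map42_P_eq`);
* ANY reading `jH : M.HB →ₗ[ℂ] T.H` of the record's complex carrier into the tower (J-record: `HB := Tower`, `jH := id`);
* the S3 JUNCTION at the level `K`: a `ℚ`-linear `rj : Λ.AKQ (C.levelOf K.K) →ₗ[ℚ] H¹(P_K; ℚ)` with
  `hj : resTotal K (jH (M.ι ((Λ.transKQ _ ⊗ ℂ) (z ⊗ x)))) = z ⊗ rj x` on pure tensors (J-record pin: `rj := (transMor 1 ≫ albOnComponent K₁ 1)^*`, the identity-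
  component Albanese map of [Liu2021] proof of Lem. 2.4 (1) l. 1220–1222 read on `P_K`; `hj` := the J-record's tower law, prove-3's
  `tower_eq_pin` ∕ prove-2's junction lemma) — giving `XK := AK`, `albK := refl`, `resX := rj ⊗ ℂ`, `tower_eq := hj`;
* the S4 JUNCTION: `jf f : P_K ⟶ A_μ ⊗ ℂ` per real morphism `f : A_{K₁} → A_μ` with `hrj : (rj ∘ φ_f^*) ⊗ ℂ (M.α) = (jf f)^*_ℂ α₀`
  (J-record pin: `jf f := transMor 1 ≫ albOnComponent K₁ 1 ≫ f_ℂ`, `hrj := pull_comp`, `α₀ := M.α`) — giving, with ✔ `exists_eq_rat_tmul`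
  (`φ = q_φ ⊗ f_φ`), `qOf φ := q_φ`, `f_of φ := jf f_φ ≫ u q_φ` and `geom_eq` (prove-4's architecture (J1), `HcmS4PiecesShape`);
* the S1 JUNCTION: ANY `ℚ`-family `dLiu : ℚ → LiuCMSide` of CM records with morphisms `u q : A_μ ⊗ ℂ ⟶ (dLiu q).A` transporting the
  eigenclass, `hu : (f ≫ u q)^*_ℂ (dLiu q).α = (q : ℂ) • f^*_ℂ α₀` (prove-1's `dLiu` ∕ `baseChange_pull_dLiu_α`: Liu's OWN datum
  `D_μ` read as a model record, `α_{d_q} = q • α`), ADMISSIBLE at the index: `hadm : ∀ q, adm i (dLiu q)` (prove-1's `admLiu` =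
  [Liu2021] Def. 4.5 (2) ⇒ reflex type, + X3-Char `typeOfLine (line i) = Φ_{μ_i}` at the pin) — giving `CM := LiuCMSide`, `Mor d := (P_K ⟶ d.A)`,
  `geom := geomClass K`, `geom_mem := geomClass_mem_cmClasses`, `admLiu := hadm`.

`HcmPieces` is a TYPE (data + laws), so the deliverable is `Nonempty (HcmPieces …)` (kernel-checked theorem); the assembly takes
`Classical.choice`, exactly as ✔ `nonempty_hcmPieces_univ` is consumed in `thm418Combined_of_asPrinted_resolved_small`.
Nothing about Liu's objects is asserted: every input is a named binder discharged by its owner's pin file (J-record: prove-2 ∕ prove-5;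
S1: prove-1; X3-Char: pin-3 ∕ the Ω-pin).  HC_CM is NOT proved; «Δ2 BRIDGE CLOSED» is NOT claimed.

## References
* [Liu2021] Y. Liu, arXiv:2102.11518 = Camb. J. Math. 9 (2021): Thm. 4.18 (l. 2232–2245) with proof, map (4.2)/(4.3) (l. 2247–2253);
  Thm. 4.18 (1) (l. 2239); Rem. 4.17 (l. 2226–2228); Lem. 2.4 (1) with proof (l. 1210–1228); Def. 2.3; Def. 4.5 (2) (l. 1944–1951);
  §4.2 l. 2062–2081 (`A_K = Alb_{X_K}`, `A_∞`, `H¹_{B,τ'}(A_∞, ℂ)`).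
-/

set_option autoImplicit false

noncomputable section

open scoped TensorProduct

namespace Summit.HodgeConjecture.CorCM.D2Bridge

open CategoryTheory
open Literature.AlgebraicGeometry.Motives (SchemeOver AbelianVariety bettiCohomology)
open Literature.AlgebraicGeometry.HodgeTheory
open Literature.AlgebraicGeometry.HodgeTheory.BettiUniverse (pull)
open Literature.AlgebraicGeometry.ShimuraVarieties.UnitaryCanonicalModel
open Literature.NumberTheory.Automorphic Literature.NumberTheory.Automorphic.PicardCM
open Literature.NumberTheory.Automorphic.Liu2021 Literature.NumberTheory.Automorphic.Liu2021.AppendixC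
open Literature.NumberTheory.Automorphic.Liu2021.AppendixC.RestOne
open Literature.NumberTheory.Transcendental (Arapura2012_Cor_15_4_6)
open HodgeCM.Model HodgeCM.Model.TowerCarrier
open HodgeCM.Literature.Theta.LiuAlbaneseModuleDatum.D2Bridge (HcmPieces)

section PiecesAtTower

variable {hHD : exists_isReal_hodgeModel} {hI : hodgePQ_independent_of_hodgeModel}
  {h₁ : BallQuotientUniformised} {h₃ : CMAbelianVarietyRealised} {hA : Arapura2012_Cor_15_4_6}
variable {L : HodgeCM.CMField} {ι₁ : (L : Type) →+* ℂ} (V : HodgeCM.HermSpace3 L ι₁)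
-- the tower dictionary's remaining parameters (DECISION #8: `Ω i a := (line i).Ω ιV (χof i a)`; any family here)
variable (Char : Type) (Adm : Char → Type) (Ω : (i : Char) → Adm i → Type)
  [∀ i a, AddCommGroup (Ω i a)] [∀ i a, Module ℂ (Ω i a)] [∀ i a, Module (adelicAlgebra V) (Ω i a)]
  [∀ i a, IsScalarTower ℂ (adelicAlgebra V) (Ω i a)] (PhiMu : Char → Prop) (adm : Char → LiuCMSide → Prop)
-- Liu's §4.2 standing datum over the honest Prop-C.5 datum (so that `C.G = ↥V.adelicFin` on the nose)
variable (h : exists_recordSystem) (Φ : Literature.AlgebraicGeometry.Motives.CMType L) {isotropicAt : ℕ → Prop}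
  (C : Sec42Data (Model.honestP5Of h ⟨L.K⟩ ι₁ ⟨V.Hm, V.isHermitian, V.signature_ι₁, V.posDef_of_ne⟩ Φ) isotropicAt)
-- the one-object rest: `D_μ`, `A_μ`, `Ω(μ)`, `res` REAL; the Weil side and `rhoΩ` FREE (δ′-agnostic)
variable [Algebra (L : Type) ℂ]
  {Lg : Type} [Field Lg] [NumberField Lg] [IsGalois ℚ Lg] (emb : (L : Type) →ₐ[ℚ] Lg) (ιg : Lg →+* ℂ)
  {μ : Literature.NumberTheory.Automorphic.IdeleClassGroup (L : Type) →ₜ* Circle} (hμ : Literature.NumberTheory.Automorphic.IdeleClassGroup.IsConjugateSymplectic (L : Type) μ)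
  (hw : Literature.NumberTheory.Automorphic.IdeleClassGroup.HasWeight (L : Type) μ 1) (Car : Def45.Carriers (L : Type) μ)
  (Eps : Type) (epsOf : L → Eps) (Chi : Type) (omega : Eps → Chi → Type)
  [∀ ε χ, AddCommGroup (omega ε χ)] [∀ ε χ, Module ℂ (omega ε χ)]
  (rho : ∀ ε χ, Representation ℂ C.G (omega ε χ))
  (rhoΩ : Representation (fieldOfValues (L : Type) μ) C.G (ΩOne C emb ιg hμ hw Car))

/-- **Δ2 BRIDGE, PIN (d): THE PIECES `HcmPieces` AT THE TOWER DICTIONARY, from the named junction inputs** (see the module docstring for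
the dictionary of binders).  For every record `M` of the proof's objects over the one-object rest whose pull-back is the constructed
(4.2) (`hMP`), every reading `jH` of its complex carrier into the tower, every level `K`, and the junction inputs `rj ∕ hj` (S3:
tower bookkeeping + Lem. 2.4 (1) at the identity component), `jf ∕ hrj` (S4: functoriality of `f ↦ f^*`), `dLiu ∕ u ∕ hu ∕ hadm` (S1:
Liu's own CM datum as an admissible model record with its transported eigenclass), the structure
`HcmPieces (toThm418Data C (restOne …)) M T.H jH K.K (H¹(P_K; ℂ)) (resTotal … K) (T.cmClasses K i)` at
`T := LiuDictionary.ofTower hHD hI h₁ h₃ hA V Char Adm Ω PhiMu adm` is INHABITED — with `AK := XK := ℂ ⊗ Λ.AKQ (C.levelOf K.K)`,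
`phiStar φ := (Λ.phiStarQHom _ φ) ⊗ ℂ`, `transK := M.ι ∘ (Λ.transKQ _ ⊗ ℂ)`, `P_eq := map42_P_eq` (S2), `albK := refl`, `resX := rj ⊗ ℂ`,
`tower_eq := hj` (S3), `CM := LiuCMSide`, `geom := geomClass K`, `geom_mem := geomClass_mem_cmClasses`, `admLiu := hadm` (S1),
`qOf φ ⊗ f_φ = φ` (✔ `exists_eq_rat_tmul`), `f_of φ := jf f_φ ≫ u (qOf φ)`, `geom_eq := hrj + hu` (S4).  HC_CM is NOT proved;
«Δ2 BRIDGE CLOSED» is NOT claimed; nothing here is a display or a pointer move.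
[cite: Liu2021, Thm. 4.18 (1) (FJcycle.tex l. 2239), Rem. 4.17 (l. 2226–2228), proof of Thm. 4.18 map (4.2)/(4.3) (l. 2247–2253), Lem. 2.4 (1) (l. 1210–1228), Def. 4.5 (2) (l. 1944–1951)] -/
theorem nonempty_hcmPieces_ofTower
    (M : (toThm418Data C (restOne C emb ιg hμ hw Car Eps epsOf Chi omega rho rhoΩ)).Map43RationalData)
    (Λ : LevelwiseBettiPullback C (AμOne emb ιg hμ hw Car M.Dμ) M.L M.U)
    (hMP : M.P = PΩOne C emb ιg hμ hw Car M.Dμ Λ)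
    (jH : M.HB →ₗ[ℂ] (LiuDictionary.ofTower hHD hI h₁ h₃ hA V Char Adm Ω PhiMu adm).H)
    (i : Char) (K : HodgeCM.Level V)
    -- ── S3 junction: the level-`K₁` tower map read on `P_K` by `res ∘ jH ∘ ι` IS the complexified `ℚ`-linear `rj` ──
    (rj : Λ.AKQ (C.levelOf K.K) →ₗ[ℚ]
      (picardCMUniverse hHD hI h₁ h₃).Coh ((picardCMUniverse hHD hI h₁ h₃).pms L ι₁ V K) 1)
    (hj : ∀ (z : ℂ) (x : Λ.AKQ (C.levelOf K.K)),
      resTotal hHD hI (ballQuotientUniformisedDatum_of h₁) h₃ hA K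
          (jH (M.ι ((Λ.transKQ (C.levelOf K.K)).baseChange ℂ (z ⊗ₜ[ℚ] x)))) = z ⊗ₜ[ℚ] rj x)
    -- ── S4 junction: `rj ∘ f^*` on the eigenclass is ONE complexified pull-back along `jf f : P_K ⟶ A_μ ⊗ ℂ` ──
    (α₀ : ℂ ⊗[ℚ] bettiCohomology ((AμOne emb ιg hμ hw Car M.Dμ).baseChange ℂ).X 1)
    (jf : (C.A (C.levelOf K.K) ⟶ AμOne emb ιg hμ hw Car M.Dμ) →
      ((pmsRealisation (ballQuotientUniformisedDatum_of h₁) (pmsCode L ι₁ V K)).X ⟶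
        ((AμOne emb ιg hμ hw Car M.Dμ).baseChange ℂ).X))
    (hrj : ∀ f : C.A (C.levelOf K.K) ⟶ AμOne emb ιg hμ hw Car M.Dμ,
      (rj ∘ₗ Λ.phiStarQ (C.levelOf K.K) f).baseChange ℂ M.α = (pull (jf f) 1).baseChange ℂ α₀)
    -- ── S1 junction: Liu's own CM datum as a `ℚ`-family of model records, eigenclass transported along `u`, admissible at `i` ──
    (dLiu : ℚ → LiuCMSide)
    (u : ∀ q : ℚ, ((AμOne emb ιg hμ hw Car M.Dμ).baseChange ℂ).X ⟶ (dLiu q).A.X)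
    (hu : ∀ (q : ℚ) (Y : SchemeOver ℂ) (f : Y ⟶ ((AμOne emb ιg hμ hw Car M.Dμ).baseChange ℂ).X),
      (pull (f ≫ u q) 1).baseChange ℂ (dLiu q).α = (q : ℂ) • (pull f 1).baseChange ℂ α₀)
    (hadm : ∀ q : ℚ, adm i (dLiu q)) :
    Nonempty (HcmPieces.{0, 1, 0} (toThm418Data C (restOne C emb ιg hμ hw Car Eps epsOf Chi omega rho rhoΩ)) M
      (LiuDictionary.ofTower hHD hI h₁ h₃ hA V Char Adm Ω PhiMu adm).H jH K.K
      ((picardCMUniverse hHD hI h₁ h₃).CohC ((picardCMUniverse hHD hI h₁ h₃).pms L ι₁ V K) 1)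
      (resTotal hHD hI (ballQuotientUniformisedDatum_of h₁) h₃ hA K)
      ((LiuDictionary.ofTower hHD hI h₁ h₃ hA V Char Adm Ω PhiMu adm).cmClasses K i)) := by
  classical
  -- S3: the junction law on pure tensors IS the equality of the two `ℂ`-linear maps `ℂ ⊗_ℚ AKQ → H¹(P_K; ℂ)`
  have hj' : resTotal hHD hI (ballQuotientUniformisedDatum_of h₁) h₃ hA K ∘ₗ jH ∘ₗ M.ι ∘ₗ
      (Λ.transKQ (C.levelOf K.K)).baseChange ℂ = rj.baseChange ℂ :=
    TensorProduct.AlgebraTensorModule.ext fun z x => (hj z x).trans (LinearMap.baseChange_tmul rj z x).symm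
  -- S4: every `φ ∈ ℚ ⊗_ℤ Hom_E(A_{K₁}, A_μ)` is `q_φ ⊗ f_φ` (✔ `exists_eq_rat_tmul`)
  choose qOf fOf hrepr using fun φ : C.HomQ (C.levelOf K.K) (AμOne emb ιg hμ hw Car M.Dμ) => exists_eq_rat_tmul φ
  refine ⟨{
    -- ── S2 (prove-2, ✔ `map42_P_eq`) ──
    AK := ℂ ⊗[ℚ] Λ.AKQ (C.levelOf K.K)
    phiStar := fun φ => (Λ.phiStarQHom (C.levelOf K.K) φ).baseChange ℂ
    transK := M.ι ∘ₗ (Λ.transKQ (C.levelOf K.K)).baseChange ℂ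
    P_eq := fun φ => map42_P_eq C emb ιg hμ hw Car Eps epsOf Chi omega rho rhoΩ M Λ hMP K.K φ
    -- ── S3 (tower bookkeeping; the junction `hj`) ──
    XK := ℂ ⊗[ℚ] Λ.AKQ (C.levelOf K.K)
    albK := LinearEquiv.refl ℂ _
    resX := rj.baseChange ℂ
    tower_eq := fun c => LinearMap.congr_fun hj' c
    -- ── S1 (the dictionary's comprehension `cmClasses`; Liu's own datum admissible) ──
    CM := LiuCMSide
    adm := adm i
    Mor := fun d => (pmsRealisation (ballQuotientUniformisedDatum_of h₁) (pmsCode L ι₁ V K)).X ⟶ d.A.X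
    geom := fun d f => LiuDictionary.geomClass (hHD := hHD) (hI := hI) (h₃ := h₃) K d f
    geom_mem := fun d hd f =>
      (LiuDictionary.ofTower hHD hI h₁ h₃ hA V Char Adm Ω PhiMu adm).geomClass_mem_cmClasses hd f
    dLiu := dLiu
    admLiu := hadm
    -- ── S4 (functoriality; the junction `hrj` and the transport `hu`) ──
    qOf := fun φ => qOf φ
    f_of := fun φ => jf (fOf φ) ≫ u (qOf φ)
    geom_eq := fun φ => ?_ }⟩
  -- `resX (albK (phiStar φ α)) = geom (dLiu q_φ) (jf f_φ ≫ u q_φ)`: the level map at `φ = q_φ ⊗ f_φ` is `q_φ • f_φ^*`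
  have hφ : Λ.phiStarQHom (C.levelOf K.K) φ = qOf φ • Λ.phiStarQ (C.levelOf K.K) (fOf φ) :=
    (congrArg (Λ.phiStarQHom (C.levelOf K.K)) (hrepr φ)).trans (Λ.phiStarQHom_tmul _ _ _)
  show (rj.baseChange ℂ ∘ₗ (Λ.phiStarQHom (C.levelOf K.K) φ).baseChange ℂ) M.α =
    (pull (jf (fOf φ) ≫ u (qOf φ)) 1).baseChange ℂ (dLiu (qOf φ)).α
  rw [← LinearMap.baseChange_comp, hφ, LinearMap.comp_smul, LinearMap.baseChange_smul, LinearMap.smul_apply, hrj, hu]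
  -- `q • v = (q : ℂ) • v` (the two `ℚ`-actions on `ℂ ⊗_ℚ H¹(P_K; ℚ)` agree definitionally, not syntactically: close by `exact`)
  exact (ratCast_smul_eq_rat_smul (qOf φ) _).symm

end PiecesAtTower

end Summit.HodgeConjecture.CorCM.D2Bridge

end
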